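import Literature.NumberTheory.LFunctions.ZetaClassicalRegionBounds
import Literature.NumberTheory.LFunctions.Zhang2022.Section5ExceptionalZero
import Literature.NumberTheory.LFunctions.DirichletLFunctionInverseBound
import Literature.NumberTheory.LFunctions.MertensElementary
import HarnessLib

/-!
# Zhang (2022), Lemma 8.4 — II: the analytic inputs on the contour (bounds for `L`, `1/L`, the
# exceptional zero, and the Euler-product factor of Lemma 8.3)

Topic `Literature/NumberTheory/LFunctions/Zhang2022` (Landau–Siegel audit tree; verdict-neutral).
Y. Zhang, *Discrete mean estimates and the Landau–Siegel zero*, arXiv:2211.02515v1 (2022)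
[Zhang2022LandauSiegel] — **an unrefereed manuscript under adjudication**; DAG nodes `Z22:Lem8.4.pf`,
`Z22:(8.9)` [Z22 p.46–47, tex L2399–2418]: "The contour of integration is moved in the same way as in
the proof of Lemma 8.2" — for the integrand of (8.9), which carries the factor `1/L(1+s,χ)`, this
needs (i) a LOWER bound for `|L(s,χ)|` just left of `σ = 1` away from the exceptional zero, (ii) the
location of that zero under (A), (iii) upper bounds for `L` right of `σ = 1`, and (iv) a size
bound for the factor `c∏_{q∣dr}(1 + cq^{−σ})` of Lemma 8.3 uniformly in `dr < P`. None is a new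
fact: (i)–(ii) are Montgomery–Vaughan Thm 11.4 (11.10) and Thm 11.3 as PROVED in the tree
(`DirichletZFR.exists_inv_LFunction_bounds`, `Zhang2022.lemma55_exceptionalZero`; on `σ ≥ 1` the
tree's `Section8Floor.norm_LFunction_le_right` and `Lemma82.norm_LFunction_le_left` are used), (iii) is
`|L(s,χ)| ≤ ζ(σ)`, `|1/L(s,χ)| ≤ ζ(σ)/ζ(2σ)` (tree `DirichletZFR.norm_LFunction_ge`), (iv) is
Mertens' `∑_{p≤x} 1/p ≤ log log x + 4` (tree `MertensBound.sum_inv_prime_le`). This file packages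
them in the shape consumed by the kernel proof of Lemma 8.4:

* `norm_LFunction_le_right'`, `inv_LFunction_le_right` — `‖L(s,χ)‖, ‖L(s,χ)⁻¹‖ ≤ (1+a)/a` for
  `Re s ≥ 1 + a`;
* `exceptional_package` — for `D ≥ D₀`, `χ ≠ χ₀` mod `D` with (A) `‖L(1,χ)‖ < 𝓛⁻²⁰²²`: the simple real
  zero `ρ̃ ∈ [1 − K𝓛⁻²⁰²², 1)` and `L(s,χ) ≠ 0`, `‖L(s,χ)⁻¹‖ ≤ Cℒ(1 + |s − ρ̃|⁻¹)` for
  `σ ≥ 1 − c/ℒ`, `ℒ = log D + log(|t|+4)`, `s ≠ ρ̃`;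
* `prod_primeFactors_le` — for `n < e^{𝓛⁹}`, `σ ≥ 1 − η`, `2η𝓛 ≤ 1/4`:
  `∏_{q∣n}(1 + Cq^{−σ}) ≤ exp(2C(log(2𝓛) + 4) + 4C𝓛⁹/D²)`;

Nothing about the manuscript's Theorems 1–2 or about Landau–Siegel zeros is asserted.

## References

* Y. Zhang, arXiv:2211.02515v1 (2022), §8, proof of Lemma 8.4; §5 Lemma 5.5.
  [cite: Zhang2022LandauSiegel, §8 Lemma 8.4; §5 Lemma 5.5]
* H. L. Montgomery, R. C. Vaughan, *Multiplicative Number Theory I*, CUP 2007, Thm 4.8, Thms 11.3–11.4,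
  (11.10), Thm 2.7. [cite: MontgomeryVaughan2007, Thm 4.8; Thm 11.3; Thm 11.4 (11.10); Thm 2.7]
-/

noncomputable section

open Complex Real Finset Filter

namespace Literature.NumberTheory.LFunctions.Zhang2022.Lemma84

/-! ### `L(s,χ)` on and to the right of `σ = 1` -/

section LRight

variable {q : ℕ} [NeZero q] (χ : DirichletCharacter ℂ q)

/-- **`L(s,χ)` for `Re s ≥ 1 + a`** (`a > 0`): `‖L(s,χ)‖ ≤ (1+a)/a` (`|∑χ(n)n^{-s}| ≤ ζ(σ) ≤ σ/(σ−1)`).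
[cite: MontgomeryVaughan2007, Lemma 11.1 (proof)] -/
theorem norm_LFunction_le_right' {a : ℝ} (ha : 0 < a) {s : ℂ} (hs : 1 + a ≤ s.re) :
    ‖χ.LFunction s‖ ≤ (1 + a) / a := by
  have hs1 : 1 < s.re := by linarith
  rw [DirichletCharacter.LFunction_eq_LSeries χ hs1]
  have h := ZetaClassicalRegion.norm_LSeries_le_of_norm_le_one (f := fun n : ℕ => χ (n : ZMod q))
    (fun n => χ.norm_le_one _) hs1
  refine h.trans ?_
  rw [div_le_div_iff₀ (by linarith) ha]
  nlinarith

/-- **`1/L(s,χ)` for `Re s ≥ 1 + a`** (`a > 0`): `L(s,χ) ≠ 0` and `‖L(s,χ)⁻¹‖ ≤ (1+a)/a`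
(`|L(s,χ)| ≥ ζ(2σ)/ζ(σ) ≥ (σ−1)/σ`, the tree's `DirichletZFR.norm_LFunction_ge`).
[cite: MontgomeryVaughan2007, Lemma 11.1 (proof)] -/
theorem inv_LFunction_le_right {a : ℝ} (ha : 0 < a) {s : ℂ} (hs : 1 + a ≤ s.re) :
    χ.LFunction s ≠ 0 ∧ ‖(χ.LFunction s)⁻¹‖ ≤ (1 + a) / a := by
  have hs1 : 1 < s.re := by linarith
  have hlow := DirichletZFR.norm_LFunction_ge χ hs1
  have hpos : 0 < (s.re - 1) / s.re := div_pos (by linarith) (by linarith)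
  have hne : χ.LFunction s ≠ 0 := by
    intro h; rw [h, norm_zero] at hlow; linarith
  refine ⟨hne, ?_⟩
  rw [norm_inv, inv_le_comm₀ (norm_pos_iff.2 hne) (by positivity)]
  refine le_trans ?_ hlow
  rw [inv_div, div_le_div_iff₀ (by linarith) (by linarith)]
  nlinarith

end LRight

/-! ### The exceptional zero under (A) and `1/L` to its left (MV Thms 11.3–11.4) -/

section Exceptional

/-- For every real `M` there is `D₀` with `log D ≥ M` for all `D ≥ D₀`. [folklore] -/
private theorem exists_nat_le_log (M : ℝ) : ∃ D₀ : ℕ, ∀ D : ℕ, D₀ ≤ D → M ≤ Real.log D := by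
  refine ⟨⌈Real.exp M⌉₊ + 1, fun D hD => ?_⟩
  have h1 : Real.exp M ≤ D := by
    have : (⌈Real.exp M⌉₊ : ℝ) + 1 ≤ D := by exact_mod_cast hD
    linarith [Nat.le_ceil (Real.exp M)]
  have hD0 : (0 : ℝ) < D := lt_of_lt_of_le (Real.exp_pos M) h1
  rw [Real.le_log_iff_exp_le hD0]
  exact h1

/-- **The exceptional zero and `1/L(s,χ)` next to it.** There are absolute `c ∈ (0, 1/4]`, `C ≥ 0`,
`K > 0`, `D₀` such that for every `D ≥ D₀` and every `χ ≠ χ₀` mod `D` with (A) `‖L(1,χ)‖ < (log D)⁻²⁰²²`: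
`L(s,χ)` has a simple real zero `ρ̃ < 1` with `1 − ρ̃ ≤ K(log D)⁻²⁰²²` (Zhang's Lemma 5.5, (5.15)),
and for every `s ≠ ρ̃` with `Re s ≥ 1 − c/(log D + log(|Im s|+4))`: `L(s,χ) ≠ 0` and
`‖L(s,χ)⁻¹‖ ≤ C·(log D + log(|Im s|+4))·(1 + |s − ρ̃|⁻¹)` (MV Thm 11.4, (11.10)). Both halves are
theorems of the tree (`Zhang2022.lemma55_exceptionalZero`, `DirichletZFR.exists_inv_LFunction_bounds`);
this is their conjunction for `D` large. [cite: Zhang2022LandauSiegel, §5 Lemma 5.5 (5.15)]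
[cite: MontgomeryVaughan2007, Thm 11.4 (11.10)] -/
theorem exceptional_package :
    ∃ c : ℝ, 0 < c ∧ c ≤ 1 / 4 ∧ ∃ C : ℝ, 0 ≤ C ∧ ∃ K : ℝ, 0 < K ∧ ∃ D₀ : ℕ,
      ∀ (D : ℕ) [NeZero D] (χ : DirichletCharacter ℂ D), D₀ ≤ D → χ ≠ 1 →
        ‖χ.LFunction 1‖ < (Real.log D ^ 2022)⁻¹ →
        ∃ ρ : ℝ, ρ < 1 ∧ 1 - ρ ≤ K * (Real.log D ^ 2022)⁻¹ ∧ χ.LFunction ρ = 0 ∧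
          deriv χ.LFunction ρ ≠ 0 ∧
          ∀ s : ℂ, 1 - c / (Real.log D + Real.log (|s.im| + 4)) ≤ s.re → s ≠ ρ →
            χ.LFunction s ≠ 0 ∧
            ‖(χ.LFunction s)⁻¹‖ ≤ C * (Real.log D + Real.log (|s.im| + 4)) * (1 + ‖s - ρ‖⁻¹) := by
  obtain ⟨c, hc, hc4, C, hC, -, -, -, hB⟩ := DirichletZFR.exists_inv_LFunction_bounds
  obtain ⟨D₁, K, hK, c₅, -, H⟩ := Zhang2022.lemma55_exceptionalZero
  -- `D` large enough that `K𝓛⁻²⁰²² < 2c/(𝓛 + log 4)`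
  obtain ⟨D₂, hD₂⟩ := exists_nat_le_log (max 2 (K / c))
  refine ⟨c, hc, hc4, C, hC, K, hK, max D₁ D₂, fun D _ χ hD hχ hA => ?_⟩
  have hD₁ : D₁ ≤ D := le_trans (le_max_left _ _) hD
  have hlog : max 2 (K / c) ≤ Real.log D := hD₂ D (le_trans (le_max_right _ _) hD)
  set 𝓛 : ℝ := Real.log D with h𝓛
  have h𝓛2 : 2 ≤ 𝓛 := le_trans (le_max_left _ _) hlog
  have h𝓛K : K / c ≤ 𝓛 := le_trans (le_max_right _ _) hlog
  have h𝓛0 : 0 < 𝓛 := by linarith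
  obtain ⟨ρ, hρ1, hρ0, hder, -, hKρ, -, -, -⟩ := H D hD₁ χ hχ hA
  have hlog4lt : Real.log 4 < 𝓛 := by
    have : Real.log 4 < 2 := by
      rw [Real.log_lt_iff_lt_exp (by norm_num)]
      have h1 := Real.exp_one_gt_d9
      have h2 : Real.exp 2 = Real.exp 1 * Real.exp 1 := by rw [← Real.exp_add]; norm_num
      nlinarith
    linarith
  have hlog4pos : 0 < Real.log 4 := Real.log_pos (by norm_num)
  -- `1 − 2c/(𝓛 + log 4) < ρ`
  have hρc : 1 - 2 * c / (Real.log D + Real.log 4) < ρ := by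
    have hKc : K ≤ c * 𝓛 := by rw [div_le_iff₀ hc] at h𝓛K; linarith
    have hpow : 𝓛 ^ 2 ≤ 𝓛 ^ 2022 := by
      calc 𝓛 ^ 2 = 𝓛 ^ 2 * 1 := (mul_one _).symm
        _ ≤ 𝓛 ^ 2 * 𝓛 ^ 2020 := by gcongr; exact one_le_pow₀ (by linarith)
        _ = 𝓛 ^ 2022 := by ring
    have h1 : K * (𝓛 ^ 2022)⁻¹ < 2 * c / (𝓛 + Real.log 4) := by
      rw [← div_eq_mul_inv, div_lt_div_iff₀ (by positivity) (by positivity)]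
      calc K * (𝓛 + Real.log 4) < K * (2 * 𝓛) := by
            apply mul_lt_mul_of_pos_left _ hK; linarith
        _ ≤ (c * 𝓛) * (2 * 𝓛) := by gcongr
        _ = 2 * c * 𝓛 ^ 2 := by ring
        _ ≤ 2 * c * 𝓛 ^ 2022 := by gcongr
    rw [← h𝓛]
    linarith
  refine ⟨ρ, hρ1, hKρ, hρ0, hder, fun s hs hsρ => ?_⟩
  have hne : s ≠ (ρ : ℂ) := hsρ
  exact (hB D χ hχ ρ hρ0 hρc).2.2 s hs hne

end Exceptional

/-! ### The Euler-product factor `∏_{q∣dr}(1 + Cq^{−σ})` of Lemma 8.3, uniformly in `dr < P` -/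

section EulerFactor

/-- The number of prime factors of `n ≥ 1` is at most `log n/log 2` (`2^{ω(n)} ≤ rad(n) ≤ n`). [folklore] -/
private theorem card_primeFactors_le_log {n : ℕ} (hn : n ≠ 0) :
    (n.primeFactors.card : ℝ) ≤ Real.log n / Real.log 2 := by
  have hlog2 : 0 < Real.log 2 := Real.log_pos (by norm_num)
  rw [le_div_iff₀ hlog2, ← Real.log_pow]
  have h2 : (2 : ℕ) ^ n.primeFactors.card ≤ n := by
    calc (2 : ℕ) ^ n.primeFactors.card ≤ ∏ p ∈ n.primeFactors, p :=
          Finset.pow_card_le_prod _ _ _ fun p hp => (Nat.prime_of_mem_primeFactors hp).two_le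
      _ ≤ n := Nat.le_of_dvd (Nat.pos_of_ne_zero hn) (Nat.prod_primeFactors_dvd n)
  have h2R : ((2 : ℝ)) ^ n.primeFactors.card ≤ n := by exact_mod_cast h2
  exact Real.log_le_log (by positivity) h2R

/-- **The factor `∏_{q∣n}(1 + Cq^{−σ})` is polynomial in `𝓛` on the contour.** For `n ≥ 1` with
`log n ≤ 𝓛⁹`, `𝓛 = log D ≥ 2`, `C ≥ 0`, `0 ≤ η` with `2η𝓛 ≤ 1/4`, and `σ ≥ 1 − η`:
`∏_{q∣n}(1 + Cq^{−σ}) ≤ exp(2C(log(2𝓛) + 4) + 4C𝓛⁹/D²)` — primes `q ≤ D²` contribute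
`q^{−σ} ≤ e^{1/4}/q` and Mertens' `∑_{p≤D²} 1/p ≤ log log D² + 4`; primes `q > D²` contribute
`q^{−σ} ≤ (D²)^{η−1} ≤ e^{1/4}/D²` each, and there are `≤ log n/log 2 ≤ 2𝓛⁹` of them.
[cite: Zhang2022LandauSiegel, §8 Lemma 8.3 (the bound `c∏(1+cq^{−σ})`)]
[cite: MontgomeryVaughan2007, Thm 2.7] -/
theorem prod_primeFactors_le {D n : ℕ} (hD : 2 ≤ Real.log D) (hn : n ≠ 0)
    (hnP : Real.log n ≤ Real.log D ^ 9) {C η σ : ℝ} (hC : 0 ≤ C) (hη : 0 ≤ η)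
    (hηL : 2 * η * Real.log D ≤ 1 / 4) (hσ : 1 - η ≤ σ) :
    ∏ q ∈ n.primeFactors, (1 + C * (q : ℝ) ^ (-σ)) ≤
      Real.exp (2 * C * (Real.log (2 * Real.log D) + 4) + 4 * C * Real.log D ^ 9 / (D : ℝ) ^ 2) := by
  set 𝓛 : ℝ := Real.log D with h𝓛
  have h𝓛0 : 0 < 𝓛 := by linarith
  have hD1 : (1 : ℝ) < D := by
    rcases lt_or_ge 1 (D : ℝ) with h | h
    · exact h
    · have : Real.log (D : ℝ) ≤ 0 := Real.log_nonpos (Nat.cast_nonneg D) h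
      linarith
  have hD0 : (0 : ℝ) < D := by linarith
  have hDsq : (1 : ℝ) < (D : ℝ) ^ 2 := by nlinarith
  have hDsq0 : (0 : ℝ) < (D : ℝ) ^ 2 := by positivity
  have hη1 : η ≤ 1 := by nlinarith
  -- split the prime factors at `D²`
  set S := n.primeFactors.filter (fun q : ℕ => (q : ℝ) ≤ (D : ℝ) ^ 2) with hS
  set T := n.primeFactors.filter (fun q : ℕ => ¬ (q : ℝ) ≤ (D : ℝ) ^ 2) with hT
  have hsplit : ∏ q ∈ n.primeFactors, (1 + C * (q : ℝ) ^ (-σ)) =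
      (∏ q ∈ S, (1 + C * (q : ℝ) ^ (-σ))) * ∏ q ∈ T, (1 + C * (q : ℝ) ^ (-σ)) := by
    rw [hS, hT, Finset.prod_filter_mul_prod_filter_not]
  have he14 : Real.exp (1 / 4) ≤ 2 := by
    have h := Real.abs_exp_sub_one_sub_id_le (x := 1 / 4) (by norm_num)
    have h' := (abs_le.1 h).2
    linarith
  -- pointwise bounds for `q^{-σ}`
  have hqpow : ∀ q ∈ n.primeFactors, (q : ℝ) ^ (-σ) ≤ (q : ℝ) ^ (η - 1) := fun q hq => by
    have hq1 : (1 : ℝ) ≤ q := by exact_mod_cast (Nat.prime_of_mem_primeFactors hq).one_le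
    exact Real.rpow_le_rpow_of_exponent_le hq1 (by linarith)
  have hsmall : ∀ q ∈ S, (q : ℝ) ^ (-σ) ≤ 2 * (1 / (q : ℝ)) := by
    intro q hq
    have hq' := (Finset.mem_filter.1 hq)
    have hqp := Nat.prime_of_mem_primeFactors hq'.1
    have hq0 : (0 : ℝ) < q := by exact_mod_cast hqp.pos
    have hq1 : (1 : ℝ) ≤ q := by exact_mod_cast hqp.one_le
    refine (hqpow q hq'.1).trans ?_
    rw [Real.rpow_sub hq0, Real.rpow_one, div_eq_mul_one_div]
    gcongr
    -- `q^η ≤ (D²)^η = exp(2η𝓛) ≤ e^{1/4} ≤ 2`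
    calc (q : ℝ) ^ η ≤ ((D : ℝ) ^ 2) ^ η := Real.rpow_le_rpow hq0.le hq'.2 hη
      _ = Real.exp (2 * η * 𝓛) := by
          rw [Real.rpow_def_of_pos hDsq0, Real.log_pow, h𝓛]; ring_nf
      _ ≤ Real.exp (1 / 4) := Real.exp_le_exp.2 hηL
      _ ≤ 2 := he14
  have hlarge : ∀ q ∈ T, (q : ℝ) ^ (-σ) ≤ 2 / (D : ℝ) ^ 2 := by
    intro q hq
    have hq' := (Finset.mem_filter.1 hq)
    have hqD : (D : ℝ) ^ 2 ≤ q := le_of_lt (not_le.1 hq'.2)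
    refine (hqpow q hq'.1).trans ?_
    calc (q : ℝ) ^ (η - 1) ≤ ((D : ℝ) ^ 2) ^ (η - 1) :=
          Real.rpow_le_rpow_of_nonpos hDsq0 hqD (by linarith [hη1])
      _ = Real.exp (2 * η * 𝓛) * (1 / (D : ℝ) ^ 2) := by
          rw [Real.rpow_sub hDsq0, Real.rpow_one, Real.rpow_def_of_pos hDsq0, Real.log_pow, h𝓛]
          ring_nf
      _ ≤ 2 * (1 / (D : ℝ) ^ 2) := by
          gcongr; exact (Real.exp_le_exp.2 hηL).trans he14
      _ = 2 / (D : ℝ) ^ 2 := by ring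
  -- the small primes: Mertens
  have hS_le : ∏ q ∈ S, (1 + C * (q : ℝ) ^ (-σ)) ≤ Real.exp (2 * C * (Real.log (2 * 𝓛) + 4)) := by
    have h1 : ∏ q ∈ S, (1 + C * (q : ℝ) ^ (-σ)) ≤ ∏ q ∈ S, (1 + 2 * C * (1 / (q : ℝ))) := by
      refine Finset.prod_le_prod (fun q _ => by positivity) fun q hq => ?_
      have := hsmall q hq
      nlinarith
    refine h1.trans ((Real.prod_one_add_le_exp_sum S (fun q => by positivity)).trans ?_)
    rw [Real.exp_le_exp, ← Finset.mul_sum]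
    -- `∑_{q ∈ S} 1/q ≤ ∑_{p ≤ ⌊D²⌋} 1/p ≤ log log ⌊D²⌋ + 4 ≤ log(2𝓛) + 4`
    set N : ℕ := ⌊(D : ℝ) ^ 2⌋₊ with hN
    have hN2 : 2 ≤ N := by
      rw [hN]
      have h4 : (4 : ℝ) ≤ (D : ℝ) ^ 2 := by
        have hD2 : (2 : ℝ) ≤ D := by
          rcases le_or_gt 2 (D : ℝ) with h | h
          · exact h
          · have : Real.log (D : ℝ) < Real.log 2 := Real.log_lt_log hD0 h
            have : Real.log (2 : ℝ) < 1 := by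
              rw [Real.log_lt_iff_lt_exp (by norm_num)]
              linarith [Real.exp_one_gt_d9]
            linarith
        nlinarith
      exact Nat.le_floor (by push_cast; linarith)
    have hsub : S ⊆ Nat.primesLE N := by
      intro q hq
      have hq' := Finset.mem_filter.1 hq
      rw [Nat.mem_primesLE]
      exact ⟨Nat.le_floor hq'.2, Nat.prime_of_mem_primeFactors hq'.1⟩
    have hsum : ∑ q ∈ S, 1 / (q : ℝ) ≤ Real.log (Real.log N) + 4 := by
      calc ∑ q ∈ S, 1 / (q : ℝ) ≤ ∑ p ∈ Nat.primesLE N, 1 / (p : ℝ) :=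
            Finset.sum_le_sum_of_subset_of_nonneg hsub fun p _ _ => by positivity
        _ ≤ Real.log (Real.log N) + 4 := MertensBound.sum_inv_prime_le N hN2
    have hNle : (N : ℝ) ≤ (D : ℝ) ^ 2 := Nat.floor_le hDsq0.le
    have hN0 : (0 : ℝ) < N := by exact_mod_cast (by omega : 0 < N)
    have hlogN : Real.log N ≤ 2 * 𝓛 := by
      calc Real.log N ≤ Real.log ((D : ℝ) ^ 2) := Real.log_le_log hN0 hNle
        _ = 2 * 𝓛 := by rw [Real.log_pow, h𝓛]; ring
    have hlogN0 : 0 < Real.log N := Real.log_pos (by exact_mod_cast (by omega : 1 < N))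
    have hll : Real.log (Real.log N) ≤ Real.log (2 * 𝓛) := Real.log_le_log hlogN0 hlogN
    calc 2 * C * ∑ q ∈ S, 1 / (q : ℝ) ≤ 2 * C * (Real.log (Real.log N) + 4) := by gcongr
      _ ≤ 2 * C * (Real.log (2 * 𝓛) + 4) := by gcongr
  -- the large primes: at most `log n/log 2 ≤ 2𝓛⁹` of them, each `≤ 1 + 2C/D²`
  have hT_le : ∏ q ∈ T, (1 + C * (q : ℝ) ^ (-σ)) ≤ Real.exp (4 * C * 𝓛 ^ 9 / (D : ℝ) ^ 2) := by
    have h1 : ∏ q ∈ T, (1 + C * (q : ℝ) ^ (-σ)) ≤ ∏ q ∈ T, (1 + C * (2 / (D : ℝ) ^ 2)) := by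
      refine Finset.prod_le_prod (fun q _ => by positivity) fun q hq => ?_
      have := hlarge q hq
      nlinarith
    refine h1.trans ((Real.prod_one_add_le_exp_sum T (fun q => by positivity)).trans ?_)
    rw [Real.exp_le_exp, Finset.sum_const, nsmul_eq_mul]
    have hcard : (T.card : ℝ) ≤ 2 * 𝓛 ^ 9 := by
      have hlog2 : (1 : ℝ) / 2 ≤ Real.log 2 := by
        have := Real.log_two_gt_d9; linarith
      have hTc : T.card ≤ n.primeFactors.card := Finset.card_filter_le _ _
      calc (T.card : ℝ) ≤ (n.primeFactors.card : ℝ) := by exact_mod_cast hTc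
        _ ≤ Real.log n / Real.log 2 := card_primeFactors_le_log hn
        _ ≤ 𝓛 ^ 9 / (1 / 2) := by
            apply div_le_div₀ (by positivity) hnP (by norm_num) hlog2
        _ = 2 * 𝓛 ^ 9 := by ring
    calc (T.card : ℝ) * (C * (2 / (D : ℝ) ^ 2)) ≤ (2 * 𝓛 ^ 9) * (C * (2 / (D : ℝ) ^ 2)) := by
          gcongr
      _ = 4 * C * 𝓛 ^ 9 / (D : ℝ) ^ 2 := by ring
  rw [hsplit, Real.exp_add]
  exact mul_le_mul hS_le hT_le (Finset.prod_nonneg fun q _ => by positivity) (Real.exp_pos _).le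

end EulerFactor

end Literature.NumberTheory.LFunctions.Zhang2022.Lemma84
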